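import Literature.Computability.AlgebraicComplexity.BLMW11StabilityInheritance
import Literature.Computability.AlgebraicComplexity.PolystabilityProofs
import Mathlib.Topology.Algebra.MvPolynomial
import HarnessLib

/-!
# `F_s(S^dW)` is Zariski closed (Bürgisser–Landsberg–Manivel–Weyman 2011, §6.4): discharge

Sibling proof file of `Literature/Computability/AlgebraicComplexity/BLMW11StabilityInheritance.lean`
(cell `val-lit`, DAG row BLMW11-A), discharging its named fact
`Literature.Computability.AlgebraicComplexity.BLMW2011_linearPowerMultiples_closed`: over `ℂ` and
finitely many variables, for `s ≤ d` the coefficient image of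
`F_s(S^dW) = {f ∈ S^dW | f = ℓ^s g, ℓ ∈ W, g ∈ S^{d-s}W}` (`linearPowerMultiples σ ℂ s d`) is Zariski
closed in coefficient space (P. Bürgisser, J. M. Landsberg, L. Manivel, J. Weyman, *An overview of
mathematical issues arising in the geometric complexity theory approach to VP ≠ VNP*, SIAM J.
Comput. 40 (2011), §6.4: "the closed subvariety `F_s(S^dW)`", with its desingularisation by the
vector bundle `S^s𝒮^* ⊗ S^{d-s}W^* → ℙW`, i.e. `F_s` is the image of a projective — hence proper —
map). Consumer in the statement file: `orbitClosure_X_pow_mul_subset_linearPowerMultiples`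
(`\overline{GL(W)·ℓ^{n-m} per_m} ⊆ F_{n-m}(S^nW)`).

## Proof

Mathlib has no proper-map / elimination theory for projective varieties, so properness of
`ℙW × S^{d-s}W → S^dW` is replaced by the route already used for polystability in
`PolystabilityProofs.lean` (`isPolystable_of_isClosed_image_slOrbit`):

1. **Zariski closure ⊆ classical closure** (the tree's `mem_closure_range_of_ker_bind₁_le`:
   Chevalley's constructibility theorem + the density theorem SGA1 XII 2.2): `F_s` is the image of the
   polynomial map `Φ : (a, b) ↦ (coefficients of (∑ aᵢ Xᵢ)^s · ∑_e b_e X^e)` on the affine space of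
   pairs (linear form, form of degree `d - s`), so a point of the Zariski closure of `coeffVec '' F_s`
   vanishes off degree `d` and its degree-`d` part lies in the classical closure of the image of `Φ`.
2. **The image of `Φ` is closed in the classical topology** (`isClosed_range_lpmCoeff`): `Φ` is
   bihomogeneous (degree `s ≥ 1` in `a`, degree `1` in `b`) and `Φ(a, b) = 0` only if `a = 0` or
   `b = 0` (`ℂ[X]` is a domain). Hence `range Φ = {0} ∪ ℝ_{≥0} · Φ(𝕊_a × 𝕊_b)` is the closed cone over
   the compact set `Φ(𝕊_a × 𝕊_b)` (unit spheres; compact as the spaces are finite-dimensional), which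
   avoids `0`; such a cone is closed (`isClosed_nonnegCone_of_isCompact`, a Bolzano–Weierstrass
   argument). This is the affine shadow of the properness of `ℙW`. (`s = 0`: `F_0 = S^dW` is a linear
   subspace, handled directly.)

Everything is proved; the two `def`s are private plumbing (the bihomogeneous family `lpmPoly` and its
generic member); no named facts, no `instance`, no `notation`.

## References

* [BurgisserEtAl2011] P. Bürgisser, J. M. Landsberg, L. Manivel, J. Weyman, SIAM J. Comput. 40(4)
  (2011) 1179–1209 = arXiv:0907.2850, §6.4 (the variety `F_s(S^dW)` and its desingularisation).
* [LandsbergGCT2017] J. M. Landsberg, *Geometry and Complexity Theory*, CUP 2017, Thm. 3.1.6.1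
  (Zariski vs. classical closure of constructible sets; the tree's `OrbitClosureEuclidean.lean`).
-/

noncomputable section

open MvPolynomial Filter Topology

namespace Literature.Computability.AlgebraicComplexity

/-! ### A closed-cone lemma -/

section Cone

variable {V : Type*} [NormedAddCommGroup V] [NormedSpace ℝ V]

/-- **The nonnegative cone over a compact set avoiding the origin is closed**: if `Q` is compact and
`0 ∉ Q` then `{c • q | c ≥ 0, q ∈ Q}` is closed (Bolzano–Weierstrass: along a convergent sequence
`c_k • q_k` the scalars `c_k ≤ ‖c_k • q_k‖ / min_Q ‖·‖` stay bounded). [folklore] -/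
private theorem isClosed_nonnegCone_of_isCompact {Q : Set V} (hQ : IsCompact Q) (h0 : (0 : V) ∉ Q) :
    IsClosed {v : V | ∃ c : ℝ, 0 ≤ c ∧ ∃ q ∈ Q, v = c • q} := by
  by_cases hne : Q.Nonempty
  swap
  · have hempty : {v : V | ∃ c : ℝ, 0 ≤ c ∧ ∃ q ∈ Q, v = c • q} = ∅ := by
      ext v
      simp only [Set.mem_setOf_eq, Set.mem_empty_iff_false, iff_false]
      rintro ⟨c, -, q, hq, -⟩
      exact hne ⟨q, hq⟩
    rw [hempty]
    exact isClosed_empty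
  -- a positive lower bound for the norm on `Q`
  obtain ⟨q₀, hq₀, hmin⟩ := hQ.exists_isMinOn hne continuous_norm.continuousOn
  set m : ℝ := ‖q₀‖ with hm
  have hm0 : 0 < m := norm_pos_iff.mpr fun h => h0 (h ▸ hq₀)
  have hmle : ∀ q ∈ Q, m ≤ ‖q‖ := fun q hq => hmin hq
  refine IsSeqClosed.isClosed fun u v hu huv => ?_
  choose c hc q hq huq using hu
  -- the sequence is bounded, hence so are the scalars
  obtain ⟨R, hR⟩ := (Metric.isBounded_range_of_tendsto u huv).exists_norm_le
  have hcR : ∀ n, c n ∈ Set.Icc (0 : ℝ) (R / m) := by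
    intro n
    refine ⟨hc n, ?_⟩
    rw [le_div_iff₀ hm0]
    have h1 : c n * m ≤ ‖u n‖ := by
      rw [huq n, norm_smul, Real.norm_of_nonneg (hc n)]
      exact mul_le_mul_of_nonneg_left (hmle _ (hq n)) (hc n)
    exact h1.trans (hR _ (Set.mem_range_self n))
  -- extract a convergent subsequence of `(c_n, q_n)` in the compact `[0, R/m] × Q`
  have hK : IsCompact (Set.Icc (0 : ℝ) (R / m) ×ˢ Q) := isCompact_Icc.prod hQ
  obtain ⟨⟨c₀, p₀⟩, ⟨hc₀, hp₀⟩, φ, hφ, hlim⟩ :=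
    hK.tendsto_subseq (x := fun n => (c n, q n)) fun n => ⟨hcR n, hq n⟩
  have h1 : Tendsto (fun n => c (φ n) • q (φ n)) atTop (𝓝 (c₀ • p₀)) :=
    ((continuous_fst.tendsto _).comp hlim).smul ((continuous_snd.tendsto _).comp hlim)
  have h2 : Tendsto (fun n => u (φ n)) atTop (𝓝 v) := huv.comp hφ.tendsto_atTop
  have h3 : (fun n => u (φ n)) = fun n => c (φ n) • q (φ n) := funext fun n => huq (φ n)
  rw [h3] at h2
  exact ⟨c₀, hc₀.1, p₀, hp₀, tendsto_nhds_unique h2 h1⟩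

end Cone

/-! ### Two general lemmas -/

section General

variable {σ : Type}

/-- A monomial exponent of degree `1` is a single variable (private copy of the tree's
`Finsupp.exists_eq_single_of_degree_eq_one` in `NonscalarBilinearRank.lean`, which imports all of
Mathlib). [folklore] -/
private theorem exists_eq_single_of_degree_eq_one' {m : σ →₀ ℕ} (hm : m.degree = 1) :
    ∃ i, m = Finsupp.single i 1 := by
  classical
  have hne : m ≠ 0 := by
    rintro rfl
    simp at hm
  obtain ⟨i, hi⟩ := Finsupp.ne_iff.1 hne
  simp only [Finsupp.coe_zero, Pi.zero_apply] at hi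
  have hsplit := Finsupp.single_add_erase i m
  have hdeg : (Finsupp.single i (m i)).degree + (m.erase i).degree = 1 := by
    rw [← map_add, hsplit, hm]
  rw [Finsupp.degree_single] at hdeg
  have hmi : m i = 1 := by omega
  have herase : (m.erase i).degree = 0 := by omega
  rw [Finsupp.degree_eq_zero_iff] at herase
  refine ⟨i, ?_⟩
  rw [← hsplit, herase, hmi, add_zero]

/-- Powers of homogeneous polynomials are homogeneous. [folklore] -/
private theorem isHomogeneous_pow' {R : Type*} [CommSemiring R] {φ : MvPolynomial σ R} {n : ℕ}
    (hφ : φ.IsHomogeneous n) (s : ℕ) : (φ ^ s).IsHomogeneous (s * n) := by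
  induction s with
  | zero => simpa using isHomogeneous_one σ R
  | succ s ih =>
    rw [pow_succ, Nat.succ_mul]
    exact ih.mul hφ

end General

/-! ### The bihomogeneous family `(a, b) ↦ (∑ aᵢ Xᵢ)^s · ∑_e b_e X^{mono e}` -/

section LinearPowerMultiples

variable {σ : Type} [Fintype σ]

/-- The bihomogeneous family: `lpmPoly s mono a b = (∑ᵢ aᵢ Xᵢ)^s · ∑_e b_e X^{mono e}`, the sum over
a finite index type `ι` of monomial exponents `mono : ι → (σ →₀ ℕ)` (below: the exponents of degree
`d - s`); coefficients in any commutative semiring, so that the generic member over `ℂ[a, b]` is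
available. [folklore] -/
private def lpmPoly {R : Type*} [CommSemiring R] {ι : Type} [Fintype ι] (s : ℕ)
    (mono : ι → (σ →₀ ℕ)) (a : σ → R) (b : ι → R) : MvPolynomial σ R :=
  (∑ i, C (a i) * X i) ^ s * ∑ e, C (b e) * monomial (mono e) 1

/-- The generic member of the family: coefficients in `ℂ[a, b]`, parameters `σ ⊕ ι`. [folklore] -/
private def lpmGeneric {ι : Type} [Fintype ι] (s : ℕ) (mono : ι → (σ →₀ ℕ)) :
    MvPolynomial σ (MvPolynomial (σ ⊕ ι) ℂ) :=
  lpmPoly s mono (fun i => X (Sum.inl i)) (fun e => X (Sum.inr e))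

variable {ι : Type} [Fintype ι] {s : ℕ} {mono : ι → (σ →₀ ℕ)}

section Algebra

variable {R : Type*} [CommSemiring R]

/-- `lpmPoly` commutes with a change of coefficient ring. [folklore] -/
private theorem map_lpmPoly {S : Type*} [CommSemiring S] (φ : R →+* S) (a : σ → R) (b : ι → R) :
    map φ (lpmPoly s mono a b) = lpmPoly s mono (φ ∘ a) (φ ∘ b) := by
  simp only [lpmPoly, map_mul, map_pow, map_sum, map_C, map_X, map_monomial, map_one,
    Function.comp_apply]

/-- The linear form `∑ aᵢ Xᵢ` is homogeneous of degree `1`. [folklore] -/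
private theorem isHomogeneous_linear (a : σ → R) :
    (∑ i, C (a i) * X i : MvPolynomial σ R).IsHomogeneous 1 :=
  IsHomogeneous.sum _ _ _ fun i _ => (isHomogeneous_X R i).C_mul (a i)

omit [Fintype σ] in
/-- The form `∑_e b_e X^{mono e}` is homogeneous of degree `n` if all `mono e` have degree `n`.
[folklore] -/
private theorem isHomogeneous_tail {n : ℕ} (hmono : ∀ e, (mono e).degree = n) (b : ι → R) :
    (∑ e, C (b e) * monomial (mono e) 1 : MvPolynomial σ R).IsHomogeneous n :=
  IsHomogeneous.sum _ _ _ fun e _ => (isHomogeneous_monomial (1 : R) (hmono e)).C_mul (b e)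

/-- `lpmPoly s mono a b` is homogeneous of degree `d = s + n`. [folklore] -/
private theorem isHomogeneous_lpmPoly {n d : ℕ} (hmono : ∀ e, (mono e).degree = n) (hsd : s + n = d)
    (a : σ → R) (b : ι → R) : (lpmPoly s mono a b).IsHomogeneous d := by
  have h := (isHomogeneous_pow' (isHomogeneous_linear a) s).mul (isHomogeneous_tail hmono b)
  rw [mul_one, hsd] at h
  exact h

/-- Scaling the linear form scales `lpmPoly` by `c^s`. [folklore] -/
private theorem lpmPoly_smul_left (c : R) (a : σ → R) (b : ι → R) :
    lpmPoly s mono (c • a) b = C (c ^ s) * lpmPoly s mono a b := by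
  have h : (∑ i, C ((c • a) i) * X i : MvPolynomial σ R) = C c * ∑ i, C (a i) * X i := by
    rw [Finset.mul_sum]
    refine Finset.sum_congr rfl fun i _ => ?_
    rw [Pi.smul_apply, smul_eq_mul, map_mul, mul_assoc]
  simp only [lpmPoly]
  rw [h, mul_pow, ← map_pow, mul_assoc]

/-- Scaling the second factor scales `lpmPoly` by `c`. [folklore] -/
private theorem lpmPoly_smul_right (c : R) (a : σ → R) (b : ι → R) :
    lpmPoly s mono a (c • b) = C c * lpmPoly s mono a b := by
  have h : (∑ e, C ((c • b) e) * monomial (mono e) 1 : MvPolynomial σ R) =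
      C c * ∑ e, C (b e) * monomial (mono e) 1 := by
    rw [Finset.mul_sum]
    refine Finset.sum_congr rfl fun e _ => ?_
    rw [Pi.smul_apply, smul_eq_mul, map_mul, mul_assoc]
  simp only [lpmPoly]
  rw [h, mul_left_comm]

/-- For `s ≥ 1` the family vanishes on `a = 0`. [folklore] -/
private theorem lpmPoly_zero_left (hs : 1 ≤ s) (b : ι → R) :
    lpmPoly s mono (0 : σ → R) b = 0 := by
  simp only [lpmPoly, Pi.zero_apply, map_zero, zero_mul, Finset.sum_const_zero,
    zero_pow (Nat.pos_iff_ne_zero.mp hs)]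

omit [Fintype ι] in
/-- The family vanishes on `b = 0`. [folklore] -/
private theorem lpmPoly_zero_right [Fintype ι] (a : σ → R) :
    lpmPoly s mono a (0 : ι → R) = 0 := by
  simp only [lpmPoly, Pi.zero_apply, map_zero, zero_mul, Finset.sum_const_zero, mul_zero]

variable [DecidableEq σ]

/-- Coefficients of the linear form: `coeff (single i 1) (∑ aⱼ Xⱼ) = aᵢ`. [folklore] -/
private theorem coeff_single_linear (a : σ → R) (i : σ) :
    coeff (Finsupp.single i 1) (∑ j, C (a j) * X j : MvPolynomial σ R) = a i := by
  rw [coeff_sum]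
  simp_rw [coeff_C_mul, coeff_X, mul_ite, mul_one, mul_zero]
  rw [Finset.sum_eq_single i]
  · rw [if_pos rfl]
  · intro j _ hj
    rw [if_neg]
    intro h
    exact hj (Finsupp.single_left_injective one_ne_zero h)
  · intro h
    exact absurd (Finset.mem_univ i) h

omit [Fintype σ] in
/-- Coefficients of the second factor: `coeff (mono e) (∑_{e'} b_{e'} X^{mono e'}) = b_e` when
`mono` is injective. [folklore] -/
private theorem coeff_tail (hinj : Function.Injective mono) (b : ι → R) (e : ι) :
    coeff (mono e) (∑ e', C (b e') * monomial (mono e') 1 : MvPolynomial σ R) = b e := by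
  rw [coeff_sum]
  simp_rw [coeff_C_mul, coeff_monomial, mul_ite, mul_one, mul_zero]
  rw [Finset.sum_eq_single e]
  · rw [if_pos rfl]
  · intro e' _ he'
    rw [if_neg]
    intro h
    exact he' (hinj h)
  · intro h
    exact absurd (Finset.mem_univ e) h

/-- The linear form vanishes only for `a = 0`. [folklore] -/
private theorem linear_eq_zero_iff (a : σ → R) :
    (∑ j, C (a j) * X j : MvPolynomial σ R) = 0 ↔ a = 0 := by
  constructor
  · intro h
    funext i
    have := coeff_single_linear a i
    rw [h, coeff_zero] at this
    exact this.symm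
  · rintro rfl
    simp

omit [Fintype σ] in
/-- The second factor vanishes only for `b = 0` (`mono` injective). [folklore] -/
private theorem tail_eq_zero_iff (hinj : Function.Injective mono) (b : ι → R) :
    (∑ e', C (b e') * monomial (mono e') 1 : MvPolynomial σ R) = 0 ↔ b = 0 := by
  constructor
  · intro h
    funext e
    have := coeff_tail hinj b e
    rw [h, coeff_zero] at this
    exact this.symm
  · rintro rfl
    simp

end Algebra

section Complex

/-- **Non-degeneracy**: for `s ≥ 1`, `lpmPoly s mono a b = 0` only if `a = 0` or `b = 0` (`ℂ[X]` is
a domain). [folklore] -/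
private theorem lpmPoly_eq_zero [DecidableEq σ] (hs : 1 ≤ s) (hinj : Function.Injective mono)
    {a : σ → ℂ} {b : ι → ℂ} (h : lpmPoly s mono a b = 0) : a = 0 ∨ b = 0 := by
  simp only [lpmPoly] at h
  rcases mul_eq_zero.mp h with h1 | h2
  · exact Or.inl ((linear_eq_zero_iff a).mp ((pow_eq_zero_iff (by omega)).mp h1))
  · exact Or.inr ((tail_eq_zero_iff hinj b).mp h2)

/-- Evaluating the generic coefficients at a parameter point gives the coefficients of the member.
[folklore] -/
private theorem aeval_coeff_lpmGeneric (x : σ ⊕ ι → ℂ) (m : σ →₀ ℕ) :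
    aeval x (coeff m (lpmGeneric s mono)) = coeff m (lpmPoly s mono (x ∘ Sum.inl) (x ∘ Sum.inr)) := by
  have h : (aeval x).toRingHom (coeff m (lpmGeneric s mono)) =
      coeff m (map (aeval x).toRingHom (lpmGeneric s mono)) := (coeff_map _ _ _).symm
  have h1 : ((aeval x).toRingHom ∘ fun i : σ => (X (Sum.inl i) : MvPolynomial (σ ⊕ ι) ℂ)) =
      x ∘ Sum.inl := by
    funext i
    simp
  have h2 : ((aeval x).toRingHom ∘ fun e : ι => (X (Sum.inr e) : MvPolynomial (σ ⊕ ι) ℂ)) =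
      x ∘ Sum.inr := by
    funext e
    simp
  change (aeval x).toRingHom (coeff m (lpmGeneric s mono)) = _
  rw [h, lpmGeneric, map_lpmPoly, h1, h2]

variable (s mono) in
/-- **The image of the coefficient map is closed** (classical topology): for `1 ≤ s`, the set of
degree-`d` coefficient vectors of the `lpmPoly s mono a b` (`mono` an injective family of exponents of
degree `n`, `s + n = d`) is `{0} ∪` the nonnegative cone over the image of the product of unit spheres,
a compact set avoiding `0`. This is the affine shadow of the properness of `ℙW × S^{d-s}W → S^dW` in
BLMW's desingularisation of `F_s(S^dW)`.
[cite: BurgisserEtAl2011, §6.4 (the variety `F_s(S^dW)`, desingularisation)] -/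
theorem isClosed_range_lpmCoeff [DecidableEq σ] {n d : ℕ} [Fintype {e : σ →₀ ℕ // e.degree = d}]
    (hs : 1 ≤ s) (hmono : ∀ e, (mono e).degree = n) (hsd : s + n = d)
    (hinj : Function.Injective mono) :
    IsClosed (Set.range fun (p : (σ → ℂ) × (ι → ℂ))
      (t : {e : σ →₀ ℕ // e.degree = d}) => coeff t.1 (lpmPoly s mono p.1 p.2)) := by
  set Φ : (σ → ℂ) × (ι → ℂ) → ({e : σ →₀ ℕ // e.degree = d} → ℂ) :=
    fun p t => coeff t.1 (lpmPoly s mono p.1 p.2) with hΦ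
  -- continuity, through the generic member
  have hcont : Continuous Φ := by
    have hΦ' : Φ = fun p t => aeval (Sum.elim p.1 p.2) (coeff t.1 (lpmGeneric s mono)) := by
      funext p t
      rw [aeval_coeff_lpmGeneric, Sum.elim_comp_inl, Sum.elim_comp_inr]
    rw [hΦ']
    refine continuous_pi fun t => ?_
    have hc : Continuous fun x : σ ⊕ ι → ℂ => aeval x (coeff t.1 (lpmGeneric s mono)) := by
      change Continuous fun x : σ ⊕ ι → ℂ => eval x (coeff t.1 (lpmGeneric s mono))
      exact continuous_eval _
    refine hc.comp (continuous_pi fun j => ?_)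
    rcases j with i | e
    · exact (continuous_apply i).comp continuous_fst
    · exact (continuous_apply e).comp continuous_snd
  -- homogeneity and non-degeneracy of `Φ`
  have hsmul_left : ∀ (c : ℂ) (a : σ → ℂ) (b : ι → ℂ), Φ (c • a, b) = c ^ s • Φ (a, b) := by
    intro c a b
    funext t
    simp only [hΦ, Pi.smul_apply, smul_eq_mul]
    rw [lpmPoly_smul_left, coeff_C_mul]
  have hsmul_right : ∀ (c : ℂ) (a : σ → ℂ) (b : ι → ℂ), Φ (a, c • b) = c • Φ (a, b) := by
    intro c a b
    funext t
    simp only [hΦ, Pi.smul_apply, smul_eq_mul]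
    rw [lpmPoly_smul_right, coeff_C_mul]
  have hleft0 : ∀ b : ι → ℂ, Φ (0, b) = 0 := by
    intro b
    funext t
    simp only [hΦ, Pi.zero_apply]
    rw [lpmPoly_zero_left hs, coeff_zero]
  have hright0 : ∀ a : σ → ℂ, Φ (a, 0) = 0 := by
    intro a
    funext t
    simp only [hΦ, Pi.zero_apply]
    rw [lpmPoly_zero_right, coeff_zero]
  have hzero : ∀ (a : σ → ℂ) (b : ι → ℂ), Φ (a, b) = 0 → a = 0 ∨ b = 0 := by
    intro a b h
    refine lpmPoly_eq_zero hs hinj ?_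
    -- all degree-`d` coefficients vanish and `lpmPoly` is homogeneous of degree `d`
    ext m
    rw [coeff_zero]
    by_cases hm : m.degree = d
    · exact congr_fun h ⟨m, hm⟩
    · exact (isHomogeneous_lpmPoly hmono hsd a b).coeff_eq_zero hm
  -- the compact set `Q = Φ(𝕊 × 𝕊)` avoids `0`
  set K : Set ((σ → ℂ) × (ι → ℂ)) :=
    Metric.sphere (0 : σ → ℂ) 1 ×ˢ Metric.sphere (0 : ι → ℂ) 1 with hK
  have hKc : IsCompact K := (isCompact_sphere _ _).prod (isCompact_sphere _ _)
  have hQc : IsCompact (Φ '' K) := hKc.image hcont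
  have hQ0 : (0 : {e : σ →₀ ℕ // e.degree = d} → ℂ) ∉ Φ '' K := by
    rintro ⟨⟨a, b⟩, ⟨ha, hb⟩, hab⟩
    rw [mem_sphere_zero_iff_norm] at ha hb
    rcases hzero a b hab with h | h
    · rw [h, norm_zero] at ha
      exact zero_ne_one ha
    · rw [h, norm_zero] at hb
      exact zero_ne_one hb
  -- `range Φ = {0} ∪ cone(Q)`
  have hrange : Set.range Φ = {0} ∪ {v | ∃ c : ℝ, 0 ≤ c ∧ ∃ q ∈ Φ '' K, v = c • q} := by
    ext v
    constructor
    · rintro ⟨⟨a, b⟩, rfl⟩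
      by_cases ha : a = 0
      · left
        rw [Set.mem_singleton_iff, ha, hleft0]
      by_cases hb : b = 0
      · left
        rw [Set.mem_singleton_iff, hb, hright0]
      right
      have ha' : ‖a‖ ≠ 0 := norm_ne_zero_iff.mpr ha
      have hb' : ‖b‖ ≠ 0 := norm_ne_zero_iff.mpr hb
      set a₁ : σ → ℂ := (‖a‖⁻¹ : ℝ) • a with ha₁
      set b₁ : ι → ℂ := (‖b‖⁻¹ : ℝ) • b with hb₁
      have hna : ‖a₁‖ = 1 := by
        rw [ha₁]
        exact norm_smul_inv_norm (𝕜 := ℝ) ha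
      have hnb : ‖b₁‖ = 1 := by
        rw [hb₁]
        exact norm_smul_inv_norm (𝕜 := ℝ) hb
      refine ⟨‖a‖ ^ s * ‖b‖, by positivity, Φ (a₁, b₁), ⟨(a₁, b₁), ⟨?_, ?_⟩, rfl⟩, ?_⟩
      · show a₁ ∈ Metric.sphere (0 : σ → ℂ) 1
        rw [mem_sphere_zero_iff_norm, hna]
      · show b₁ ∈ Metric.sphere (0 : ι → ℂ) 1
        rw [mem_sphere_zero_iff_norm, hnb]
      · have h1 : a = ((‖a‖ : ℝ) : ℂ) • a₁ := by
          rw [Complex.coe_smul, ha₁, smul_smul, mul_inv_cancel₀ ha', one_smul]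
        have h2 : b = ((‖b‖ : ℝ) : ℂ) • b₁ := by
          rw [Complex.coe_smul, hb₁, smul_smul, mul_inv_cancel₀ hb', one_smul]
        rw [← Complex.coe_smul]
        conv_lhs => rw [h1, h2]
        rw [hsmul_left, hsmul_right, smul_smul]
        push_cast
        rfl
    · rintro (hv | ⟨c, -, q, ⟨⟨a, b⟩, -, rfl⟩, rfl⟩)
      · rw [Set.mem_singleton_iff] at hv
        exact ⟨((0 : σ → ℂ), (0 : ι → ℂ)), by rw [hv, hleft0]⟩
      · refine ⟨(a, (c : ℂ) • b), ?_⟩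
        rw [hsmul_right, Complex.coe_smul]
  change IsClosed (Set.range Φ)
  rw [hrange]
  exact isClosed_singleton.union (isClosed_nonnegCone_of_isCompact hQc hQ0)

end Complex

/-! ### `F_s(S^dW)` as the image of the family -/

variable [DecidableEq σ]

/-- Every `lpmPoly` with exponents of degree `d - s` lies in `F_s(S^dW)`. [folklore] -/
private theorem lpmPoly_mem {d : ℕ} (hmono : ∀ e, (mono e).degree = d - s) (a : σ → ℂ) (b : ι → ℂ) :
    lpmPoly s mono a b ∈ linearPowerMultiples σ ℂ s d :=
  ⟨_, _, isHomogeneous_linear a, isHomogeneous_tail hmono b, rfl⟩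

omit [Fintype ι] in
/-- Every element of `F_s(S^dW)` is a member of the family indexed by the exponents of degree
`d - s` (read off the coefficients of `ℓ` and `g`). [folklore] -/
private theorem exists_lpmPoly_eq_of_mem {d : ℕ} [Fintype {e : σ →₀ ℕ // e.degree = d - s}]
    {f : MvPolynomial σ ℂ} (hf : f ∈ linearPowerMultiples σ ℂ s d) :
    ∃ (a : σ → ℂ) (b : {e : σ →₀ ℕ // e.degree = d - s} → ℂ),
      f = lpmPoly s (Subtype.val : {e : σ →₀ ℕ // e.degree = d - s} → (σ →₀ ℕ)) a b := by
  obtain ⟨ℓ, g, hℓ, hg, rfl⟩ := hf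
  refine ⟨fun i => coeff (Finsupp.single i 1) ℓ, fun e => coeff e.1 g, ?_⟩
  have hℓeq : ℓ = ∑ j, C (coeff (Finsupp.single j 1) ℓ) * X j := by
    ext m
    rw [coeff_sum]
    simp_rw [coeff_C_mul, coeff_X, mul_ite, mul_one, mul_zero]
    by_cases hm : m.degree = 1
    · obtain ⟨i, rfl⟩ := exists_eq_single_of_degree_eq_one' hm
      rw [Finset.sum_eq_single i]
      · rw [if_pos rfl]
      · intro j _ hj
        rw [if_neg]
        intro h
        exact hj (Finsupp.single_left_injective one_ne_zero h)
      · intro h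
        exact absurd (Finset.mem_univ i) h
    · rw [hℓ.coeff_eq_zero hm]
      symm
      refine Finset.sum_eq_zero fun j _ => ?_
      rw [if_neg]
      rintro rfl
      exact hm (by simp)
  have hgeq : g = ∑ e : {e : σ →₀ ℕ // e.degree = d - s}, C (coeff e.1 g) * monomial e.1 1 := by
    ext m
    rw [coeff_sum]
    simp_rw [coeff_C_mul, coeff_monomial, mul_ite, mul_one, mul_zero]
    by_cases hm : m.degree = d - s
    · rw [Finset.sum_eq_single ⟨m, hm⟩]
      · rw [if_pos rfl]
      · intro e' _ he'
        rw [if_neg]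
        intro h
        exact he' (Subtype.ext h)
      · intro h
        exact absurd (Finset.mem_univ _) h
    · rw [hg.coeff_eq_zero hm]
      symm
      refine Finset.sum_eq_zero fun e' _ => ?_
      rw [if_neg]
      rintro h
      exact hm (h ▸ e'.2)
  rw [lpmPoly, ← hℓeq, ← hgeq]

end LinearPowerMultiples

/-! ### The discharge -/

/-- **BLMW 2011, §6.4: `F_s(S^dW)` is a closed subvariety — discharged.** Over `ℂ` and finitely many
variables, for `s ≤ d` the coefficient image of `F_s(S^dW) = {ℓ^s g}` is Zariski closed. Proof: a
point of the Zariski closure vanishes off degree `d`; its degree-`d` part lies in the classical closure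
of the image of the coefficient map `(a, b) ↦ coeff((∑ aᵢXᵢ)^s ∑ b_e X^e)` (Chevalley + density,
`mem_closure_range_of_ker_bind₁_le`), and that image is closed (`isClosed_range_lpmCoeff`: a closed
cone over a compact set — the shadow of the properness of `ℙW`); `s = 0` (`F_0 = S^dW`) is direct.
[cite: BurgisserEtAl2011, §6.4 (the closed subvariety `F_s(S^dW)`)] -/
theorem BLMW2011_linearPowerMultiples_closed_holds : BLMW2011_linearPowerMultiples_closed := by
  intro σ _ _ s d hsd y hy
  classical
  haveI hfinT : Fintype {e : σ →₀ ℕ // e.degree = d} :=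
    Fintype.subtype ((Finset.univ : Finset σ).finsuppAntidiag d) fun e => by
      simp [Finset.mem_finsuppAntidiag, Finsupp.degree_eq_sum]
  haveI hfinT' : Fintype {e : σ →₀ ℕ // e.degree = d - s} :=
    Fintype.subtype ((Finset.univ : Finset σ).finsuppAntidiag (d - s)) fun e => by
      simp [Finset.mem_finsuppAntidiag, Finsupp.degree_eq_sum]
  -- (i) every member of `F_s` is homogeneous of degree `d`, so `y` vanishes off degree `d`
  have hhom : ∀ f ∈ linearPowerMultiples σ ℂ s d, f.IsHomogeneous d := by
    rintro f ⟨ℓ, g, hℓ, hg, rfl⟩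
    have h := (isHomogeneous_pow' hℓ s).mul hg
    rw [mul_one, Nat.add_sub_cancel' hsd] at h
    exact h
  have hy0 : ∀ m : σ →₀ ℕ, m.degree ≠ d → y m = 0 := by
    intro m hm
    have := (mem_zariskiClosure_iff.mp hy) (X m) fun v hv => by
      obtain ⟨f, hf, rfl⟩ := hv
      rw [aeval_X, coeffVec_apply]
      exact (hhom f hf).coeff_eq_zero hm
    simpa using this
  -- the case `s = 0`: `F_0 = S^dW`, and `y` is the coefficient vector of a form of degree `d`
  rcases Nat.eq_zero_or_pos s with hs0 | hs
  · subst hs0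
    set b : {e : σ →₀ ℕ // e.degree = d} → ℂ := fun e => y e.1 with hb
    have hmono : ∀ e : {e : σ →₀ ℕ // e.degree = d}, (e.1).degree = d - 0 := fun e => by
      rw [Nat.sub_zero]; exact e.2
    refine ⟨lpmPoly 0 Subtype.val (0 : σ → ℂ) b, lpmPoly_mem hmono 0 b, ?_⟩
    funext m
    rw [coeffVec_apply]
    by_cases hm : m.degree = d
    · have : lpmPoly 0 (Subtype.val : {e : σ →₀ ℕ // e.degree = d} → (σ →₀ ℕ)) (0 : σ → ℂ) b =
          ∑ e : {e : σ →₀ ℕ // e.degree = d}, C (b e) * monomial e.1 1 := by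
        rw [lpmPoly, pow_zero, one_mul]
      rw [this, show m = (⟨m, hm⟩ : {e : σ →₀ ℕ // e.degree = d}).1 from rfl,
        coeff_tail Subtype.val_injective]
    · rw [(isHomogeneous_lpmPoly (fun e => e.2) (zero_add d) _ b).coeff_eq_zero hm, hy0 m hm]
  -- (ii) `s ≥ 1`: the degree-`d` part of `y` lies in the classical closure of the image
  set T := {e : σ →₀ ℕ // e.degree = d}
  set T' := {e : σ →₀ ℕ // e.degree = d - s}
  have hsd' : s + (d - s) = d := by omega
  have hmono : ∀ e : T', (e.1).degree = d - s := fun e => e.2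
  set P : T → MvPolynomial (σ ⊕ T') ℂ :=
    fun t => coeff t.1 (lpmGeneric s (Subtype.val : T' → (σ →₀ ℕ))) with hP
  set z : T → ℂ := fun t => y t.1 with hz
  have hker : RingHom.ker (bind₁ P : MvPolynomial T ℂ →ₐ[ℂ] MvPolynomial (σ ⊕ T') ℂ) ≤
      RingHom.ker (aeval z : MvPolynomial T ℂ →ₐ[ℂ] ℂ) := by
    intro q hq
    rw [RingHom.mem_ker] at hq ⊢
    set pq : MvPolynomial (σ →₀ ℕ) ℂ := rename (fun t : T => t.1) q with hpq
    have hev : ∀ v : (σ →₀ ℕ) → ℂ, aeval v pq = aeval (fun t : T => v t.1) q := by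
      intro v
      rw [hpq, aeval_rename]
      rfl
    have hvan : ∀ v ∈ coeffVec '' linearPowerMultiples σ ℂ s d, aeval v pq = 0 := by
      rintro _ ⟨f, hf, rfl⟩
      obtain ⟨a, b, rfl⟩ := exists_lpmPoly_eq_of_mem hf
      rw [hev]
      have h1 : (fun t : T => coeffVec (lpmPoly s Subtype.val a b) t.1) =
          fun t => aeval (Sum.elim a b) (P t) := by
        funext t
        rw [coeffVec_apply, hP]
        simp only
        rw [aeval_coeff_lpmGeneric, Sum.elim_comp_inl, Sum.elim_comp_inr]
      rw [h1, ← aeval_bind₁, hq, map_zero]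
    have := (mem_zariskiClosure_iff.mp hy) pq hvan
    rwa [hev] at this
  have hcl := mem_closure_range_of_ker_bind₁_le P hker
  -- (iii) the image is closed: reparametrise by pairs and use `isClosed_range_lpmCoeff`
  have hrange : (Set.range fun (x : σ ⊕ T' → ℂ) (t : T) => aeval x (P t)) =
      Set.range fun (p : (σ → ℂ) × (T' → ℂ)) (t : T) =>
        coeff t.1 (lpmPoly s Subtype.val p.1 p.2) := by
    ext v
    constructor
    · rintro ⟨x, rfl⟩
      refine ⟨(x ∘ Sum.inl, x ∘ Sum.inr), ?_⟩
      funext t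
      simp only [hP]
      rw [aeval_coeff_lpmGeneric]
    · rintro ⟨⟨a, b⟩, rfl⟩
      refine ⟨Sum.elim a b, ?_⟩
      funext t
      simp only [hP]
      rw [aeval_coeff_lpmGeneric, Sum.elim_comp_inl, Sum.elim_comp_inr]
  rw [hrange, (isClosed_range_lpmCoeff s Subtype.val hs hmono hsd' Subtype.val_injective).closure_eq]
    at hcl
  obtain ⟨⟨a, b⟩, hab⟩ := hcl
  -- conclude: `y` is the coefficient vector of `lpmPoly s _ a b ∈ F_s`
  refine ⟨lpmPoly s Subtype.val a b, lpmPoly_mem hmono a b, ?_⟩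
  funext m
  rw [coeffVec_apply]
  by_cases hm : m.degree = d
  · exact congr_fun hab ⟨m, hm⟩
  · rw [(isHomogeneous_lpmPoly hmono hsd' a b).coeff_eq_zero hm, hy0 m hm]

end Literature.Computability.AlgebraicComplexity

end
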